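import Summits.PneNP.PneNP.Theorems.NegLimitedAmplifiedWindowDefs

/-!
# Route NegLimited — line `amplified-window`, stub A (`MonotoneAmplification`): TYPED SUB-HELPERS
(rung F-N1/p3, ROUND-12; door item `NegLimited.NeglimitedEpsLogNegationsR`, stmt-PneNP-19860;
registered skeleton `amplified-window` v2, sha c828757ca2bc7a67; blueprint HOME/pnp-ideate-p3/r12/BLUEPRINT-A.md)

After B (`stub_criticalWindow`, p472908), EA (p466977), DA (p467364) and T (`transfer_holds`) landed, the door
rests on exactly two registered stubs: S (`stub_slicesNP`, NP plumbing, M) and **A (`stub_monotoneAmplification`,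
the XL port: Impagliazzo hard-core + O'Donnell / Healy–Vadhan–Viola hybrid for `RM3_d ⊗ f`, MONOTONE version)**.
This file cuts A into ten independently provable sub-statements `A0 … A9` over the landed objects of
`NegLimitedAmplifiedWindowDefs` (p465934: `recMaj3`, `ampFn`, `prodWeight`, `massAt`, `agreeAt`) so that several
provers can port A in parallel.  Every sub-statement is a `def … : Prop` (statement only); the composition
`AmpAssembly := A0 → … → A8 → MonotoneAmplification` is itself the (M-sized, pure bookkeeping) item A9 whose
parameter recipe is written out in its docstring and in BLUEPRINT-A.md §9.  Nothing here is proved except three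
definitional bridges (`prodWeight_eq_bw`, `ampFn_eq`, `monotoneAmplification_of_parts`).

GENERIC LAYER (any finite block set `W`, block alphabet `𝒳`; in the application `W = Fin d → Fin 3`,
`𝒳 = ι → Bool`, inputs CURRIED `X : W → 𝒳`, bridge to the uncurried `(W × ι → Bool)` of stub A = `CurryBridge`):
* `bw μ X = ∏_w μ w (X w)` — block-product weight (`prodWeight d D` is `bw (fun _ => D)` after currying);
* `cbias Φ S v` — bias `Pr_z[Φ = 1] − Pr_z[Φ = 0]` of the combiner `Φ` with the coordinates in `S` FREE (fair
  coins `z`) and the others FIXED to `v`;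
* `hybAgree μ f Φ g T` — the HYBRID agreement: weight `bw μ`, test `g`, target `Φ` applied to the block bits
  `f (X w)` except that the bits of the blocks in `T` are replaced by independent fair coins;
* `expAbsBias d p` — expected `|cbias|` of `recMaj3 d` under the `p`-random restriction with FAIR fixed bits.

THE TEN PARTS (sizes are guesses; "generic" = no circuits, pure finite sums):
* A0 `BlockRestriction` (S, circuits): fixing all blocks but one of a `{∧,∨,0,1}`-circuit costs ≤ 2 gates.
* A1 `HardCoreMonotone` (M, circuits): `NegLimitedDoor.HardCore.hardCore_measure` (p465156) instantiated for the
  class of size-`s'` monotone circuits, the MAJORITY-vote gadget built with `CktSize.pi/comp` +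
  `NegLimitedDoor.Threshold.cktSize_thrFn_fin`; ONE-SIDED advantage (referee checkpoint α).
* A2 `BalancedTrim` (S/M, generic algebra): rescale the hard-core measure on `{f=1}` / `{f=0}` separately to make it
  EXACTLY balanced with density exactly `p` (uses only that the two constants are in the class); advantage `≤ 4γ`.
* A3 `MixtureExpansion` (S, generic): `D = D·H' + D·(1−H')` blockwise ⟹ `∏_w D = Σ_S ∏_{w∈S} DH' ∏_{w∉S} DE'`
  (`Finset.prod_add`), and `agreeAt` is linear in the weight.  A3' `CurryBridge` (S): `Equiv.curry`.
* A4 `HybridStep` (M/L, generic — THE MONOTONE STEP): replacing the `f`-bit of one hard block by a fair coin costs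
  at most `η·mass`, because conditioned on everything else a MONOTONE combiner is `0`, `1` or `id` in that bit —
  never `¬` — so the one-sided agreement bound suffices (referee checkpoint β lives here and in A5).
* A5 `FinalHybridBound` (S, generic): against independent fair coins every test has agreement `≤ (1+|cbias|)/2`.
* A6 `Pushforward` (M, generic): a block-product sum of a function of the block BITS is the product-of-pushforwards
  sum (`Finset.prod_univ_sum`); with A2's exact balance the fixed bits come out EXACTLY fair.
* A7 `RM3BiasDecay` (L, RM3 only): `E|bias| ≤ √Q_d`, `Q_0 = 1−p`, `Q_{j+1} = (3Q_j + Q_j³)/4` (sign symmetry kills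
  the cross terms), hence `Q_d ≤ (16/13)^{J(p)}·(13/16)^d`, `α = ½·log₃(16/13) ≈ 0.0945 ≤ ½`.
* A8 `ProjectionCorner` (M, RM3 only): a gate-free `M` (size 0, so the size hypothesis of A is void) is a
  projection `x_{(w,i)}`; single-leaf influence of `RM3_d` is `2^{-d}` ⟹ agreement `≤ ½ + 2^{-(d+1)}`.
* A9 `AmpAssembly` (M, bookkeeping): `γ = 1/(2N²)`, `p = β/2`, `η = 2γ`, `e = 8`, `K = max(5184/β⁴, K₁/2 + 1)`.

HONEST FRAMING: statements of sub-lemmas of ONE registered stub of a line on an OPEN door item; FRONTIER rung F-N1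
(Rossman-adjacent negation-limited lower bounds) — nothing here bears on P vs NP.  A is a KNOWN theorem in print
(Impagliazzo FOCS'95; O'Donnell JCSS'04 §3–4; Healy–Vadhan–Viola SICOMP'06) ported to monotone circuits and
finite weighted sums; the port, not the mathematics, is the work.
-/

set_option linter.dupNamespace false -- `Summit.PneNP.PneNP.…`: summit = sub-problem name (D-0017 single-conjunct layout)

namespace Summit.PneNP.PneNP.Theorems.NegLimitedAmplifiedWindow.Amp

open Finset
open Literature.Computability.Complexity
open Summit.PneNP.PneNP.Theorems.NegLimitedDoor (massAt agreeAt)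

/-! ## Generic objects -/

section Generic

variable {W 𝒳 : Type} [Fintype W] [DecidableEq W] [Fintype 𝒳]

/-- Block-product weight `∏_w μ_w(X_w)` on curried block inputs `X : W → 𝒳`. -/
def bw (μ : W → 𝒳 → ℝ) (X : W → 𝒳) : ℝ := ∏ w, μ w (X w)

/-- `±1`-valued sign of a Boolean. -/
def sgn (b : Bool) : ℝ := if b then 1 else -1

/-- Bias `Pr_z[Φ = 1] − Pr_z[Φ = 0]` of the combiner `Φ` restricted by: coordinates in `S` FREE (uniform `z`),
coordinates outside `S` FIXED to `v` (the sum runs over all `z : W → Bool`; coordinates of `z` outside `S` and of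
`v` inside `S` are ignored, which only repeats terms). -/
noncomputable def cbias (Φ : (W → Bool) → Bool) (S : Finset W) (v : W → Bool) : ℝ :=
  ((2 : ℝ) ^ Fintype.card W)⁻¹ * ∑ z : W → Bool, sgn (Φ fun w => if w ∈ S then z w else v w)

/-- HYBRID AGREEMENT: total `bw μ`-weight of the inputs `X` on which the test `g` agrees with the combiner `Φ`
applied to the block bits `f (X w)`, except that for the blocks `w ∈ T` the bit is an independent fair coin
`z w` (averaged).  At `T = ∅` this is `agreeAt (bw μ) (Φ ∘ bits) g`; at `T = S` the hard blocks are pure noise. -/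
noncomputable def hybAgree (μ : W → 𝒳 → ℝ) (f : 𝒳 → Bool) (Φ : (W → Bool) → Bool) (g : (W → 𝒳) → Bool)
    (T : Finset W) : ℝ :=
  ∑ X : W → 𝒳, bw μ X * (((2 : ℝ) ^ Fintype.card W)⁻¹ *
    ∑ z : W → Bool, if g X = Φ (fun w => if w ∈ T then z w else f (X w)) then (1 : ℝ) else 0)

end Generic

/-- EXPECTED ABSOLUTE BIAS of `RM3_d` under the `p`-random restriction with FAIR fixed bits: each of the `3^d`
leaves is free with probability `p`, else fixed to a fair bit; weight of `(S, v)` = `(p/2)^{|S|}·((1−p)/2)^{3^d−|S|}`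
(the `2^{-|S|}` compensates the ignored coordinates of `v` inside `S`; total weight `1`). -/
noncomputable def expAbsBias (d : ℕ) (p : ℝ) : ℝ :=
  ∑ S : Finset (Fin d → Fin 3), ∑ v : (Fin d → Fin 3) → Bool,
    (p / 2) ^ S.card * ((1 - p) / 2) ^ (3 ^ d - S.card) * |cbias (recMaj3 d) S v|

/-! ## Definitional bridges (proved, `rfl`) -/

/-- `prodWeight` is the block-product weight of the curried input. -/
theorem prodWeight_eq_bw {ι : Type} (d : ℕ) (D : (ι → Bool) → ℝ) (x : (Fin d → Fin 3) × ι → Bool) :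
    prodWeight d D x = bw (fun _ : Fin d → Fin 3 => D) (fun w i => x (w, i)) := rfl

/-- `ampFn` is `recMaj3` of the block bits of the curried input. -/
theorem ampFn_eq {ι : Type} (d : ℕ) (f : (ι → Bool) → Bool) (x : (Fin d → Fin 3) × ι → Bool) :
    ampFn d f x = recMaj3 d (fun w => f (fun i => x (w, i))) := rfl

/-! ## The sub-statements A0 – A8 -/

/-- (A0, S) BLOCK RESTRICTION: fixing every block except `w` of a `{∧₂,∨₂,0,1}`-circuit on `(Fin d → Fin 3) × ι`
to the constants `X` yields a `{∧₂,∨₂,0,1}`-circuit on `ι` with at most two more gates (one constant-`1` and one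
constant-`0` gate feeding the frozen inputs; cf. `Circuit.exists_restrict_sup`, RossmanMonotoneCliqueThm2Proofs). -/
def BlockRestriction : Prop :=
  ∀ (ι : Type) [Fintype ι] [DecidableEq ι] (d : ℕ) (M : Circuit ((Fin d → Fin 3) × ι)),
    M.IsOver monotoneBasis01 → ∀ (w : Fin d → Fin 3) (X : (Fin d → Fin 3) → ι → Bool),
      ∃ C : Circuit ι, C.IsOver monotoneBasis01 ∧ C.size ≤ M.size + 2 ∧
        ∀ y : ι → Bool, C.eval y = M.eval (fun q => Function.update X w y q.1 q.2)

/-- (A1, M) HARD-CORE MEASURE FOR MONOTONE CIRCUITS (Impagliazzo, via `NegLimitedDoor.HardCore.hardCore_measure`,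
p465156): if every `{∧,∨,0,1}`-circuit of size `≤ s` agrees with `f` on `D`-mass `≤ 1−β`, and the size budget
`s` accommodates a MAJORITY of `t ≤ 4/(γβ)²+2/(γβ)` circuits of size `s'` (threshold gadget
`NegLimitedDoor.Threshold.cktSize_thrFn_fin`: `θ + t·2θ` gates, `θ = ⌊t/2⌋+1`), then there is a measure `H ∈ [0,1]^X`
of `D`-density `≥ β` on which every size-`s'` circuit has ONE-SIDED signed advantage `< γ`.
Key inclusion: `{x | MAJ-vote of the gᵢ against f is ≤ 0} ⊇ {x | Thr_θ(g₁ x,…,g_t x) ≠ f x}`. -/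
def HardCoreMonotone : Prop :=
  ∀ (ι : Type) [Fintype ι] [DecidableEq ι] (D : (ι → Bool) → ℝ) (f : (ι → Bool) → Bool) (s s' : ℕ)
    (β γ : ℝ), (∀ x, 0 ≤ D x) → ∑ x, D x = 1 → 0 < β → 0 < γ →
    (∀ C : Circuit ι, C.IsOver monotoneBasis01 → C.size ≤ s → agreeAt D f C.eval ≤ 1 - β) →
    (∀ t : ℕ, (t : ℝ) ≤ 4 / (γ * β) ^ 2 + 2 / (γ * β) → t * s' + (t / 2 + 1) * (2 * t + 1) ≤ s) →
    ∃ H : (ι → Bool) → ℝ, (∀ x, 0 ≤ H x) ∧ (∀ x, H x ≤ 1) ∧ β ≤ ∑ x, D x * H x ∧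
      ∀ C : Circuit ι, C.IsOver monotoneBasis01 → C.size ≤ s' →
        ∑ x, D x * H x * (if C.eval x = f x then (1 : ℝ) else -1) < γ * ∑ x, D x * H x

/-- (A2, S/M) BALANCED TRIM: a hard-core measure `H` (density `≥ β`, one-sided advantage `< γ ≤ ½` for a class
containing the two constants) can be rescaled separately on `{f = 1}` and `{f = 0}` (factors `c_b = p/(2·Z_b) ≤ 1`,
`Z_b = Σ_{f=b} D·H > (1−γ)Z/2`) into `H' ≤ H` with `D·H'` EXACTLY balanced of total mass exactly `p`, for any target
`0 < p ≤ (1−γ)β`, at the price of advantage `≤ 2γp/(1−γ) ≤ 4γ·p`. Pure finite-sum algebra. -/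
def BalancedTrim : Prop :=
  ∀ (X : Type) [Fintype X] (D H : X → ℝ) (f : X → Bool) (𝒢 : Set (X → Bool)) (β γ p : ℝ),
    (∀ x, 0 ≤ D x) → (∀ x, 0 ≤ H x) → (∀ x, H x ≤ 1) → 0 < γ → γ ≤ 1 / 2 → 0 < p → p ≤ (1 - γ) * β →
    β ≤ ∑ x, D x * H x → (fun _ => true) ∈ 𝒢 → (fun _ => false) ∈ 𝒢 →
    (∀ g ∈ 𝒢, ∑ x, D x * H x * (if g x = f x then (1 : ℝ) else -1) < γ * ∑ x, D x * H x) →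
    ∃ H' : X → ℝ, (∀ x, 0 ≤ H' x) ∧ (∀ x, H' x ≤ 1) ∧
      massAt (fun x => D x * H' x) f true = p / 2 ∧ massAt (fun x => D x * H' x) f false = p / 2 ∧
      ∀ g ∈ 𝒢, ∑ x, D x * H' x * (if g x = f x then (1 : ℝ) else -1) ≤ 4 * γ * p

/-- (A3, S) MIXTURE EXPANSION (generic identity, no hypotheses): a blockwise sum of two weights expands over the
set `S` of blocks carrying the first weight (`Finset.prod_add`), and `agreeAt` is linear in the weight. -/
def MixtureExpansion : Prop :=
  ∀ (W 𝒳 : Type) [Fintype W] [DecidableEq W] [Fintype 𝒳] (μ₁ μ₂ : 𝒳 → ℝ) (F g : (W → 𝒳) → Bool),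
    agreeAt (bw fun _ : W => μ₁ + μ₂) F g = ∑ S : Finset W, agreeAt (bw fun w => if w ∈ S then μ₁ else μ₂) F g

/-- (A3', S) CURRY BRIDGE: stub A's uncurried objects are the generic ones on curried inputs (`Equiv.curry`,
`Fintype.sum_equiv`; pointwise `prodWeight_eq_bw`, `ampFn_eq`). -/
def CurryBridge : Prop :=
  ∀ (ι : Type) [Fintype ι] [DecidableEq ι] (d : ℕ) (D : (ι → Bool) → ℝ) (f : (ι → Bool) → Bool)
    (g : ((Fin d → Fin 3) × ι → Bool) → Bool),
    agreeAt (prodWeight d D) (ampFn d f) g =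
      agreeAt (bw fun _ : Fin d → Fin 3 => D) (fun X => recMaj3 d fun w => f (X w)) (fun X => g fun q => X q.1 q.2)

/-- (A4, M/L) THE HYBRID STEP WITH A MONOTONE COMBINER (O'Donnell's hybrid, monotone version — the heart of A):
if on every hard block `w ∈ S`, for every setting `X` of the other blocks, the one-block test
`a ↦ g (update X w a)` agrees with `f` on at most `(½ + η)` of the `μ_w`-mass, then replacing the `f`-bits of ALL
hard blocks by independent fair coins lowers the agreement by at most `η·|S|·(total mass)`.
Proof = telescope over an enumeration of `S`; in one step, conditioned on the other blocks and coins, `Φ` as a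
function of the replaced bit is MONOTONE of one variable, i.e. `0`, `1` or `id` (never `¬`): constants contribute
`0`, `id` contributes `2·Σ_a μ_w a·[test = f] − mass ≤ 2η·mass`.  Tools: `Equiv.funSplitAt w`, `Finset.prod_univ_sum`,
`Fintype.prod_eq_mul_prod_compl`/`Finset.mul_prod_erase`. -/
def HybridStep : Prop :=
  ∀ (W 𝒳 : Type) [Fintype W] [DecidableEq W] [Fintype 𝒳] (μ : W → 𝒳 → ℝ) (f : 𝒳 → Bool)
    (Φ : (W → Bool) → Bool) (g : (W → 𝒳) → Bool) (S : Finset W) (η : ℝ),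
    (∀ w a, 0 ≤ μ w a) → Monotone Φ →
    (∀ w ∈ S, ∀ X : W → 𝒳,
      (∑ a, if g (Function.update X w a) = f a then μ w a else 0) ≤ (1 / 2 + η) * ∑ a, μ w a) →
    agreeAt (bw μ) (fun X => Φ fun w => f (X w)) g ≤ hybAgree μ f Φ g S + η * S.card * ∏ w, ∑ a, μ w a

/-- (A5, S) FINAL HYBRID = COINS: once the hard blocks' bits are independent fair coins, ANY test agrees with the
combiner with probability `(1 + sgn(test)·cbias)/2 ≤ (1 + |cbias|)/2` (pointwise in `X`), and
`Σ_X bw μ X = ∏_w Σ_a μ w a` (`Finset.prod_univ_sum`). -/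
def FinalHybridBound : Prop :=
  ∀ (W 𝒳 : Type) [Fintype W] [DecidableEq W] [Fintype 𝒳] (μ : W → 𝒳 → ℝ) (f : 𝒳 → Bool)
    (Φ : (W → Bool) → Bool) (g : (W → 𝒳) → Bool) (S : Finset W), (∀ w a, 0 ≤ μ w a) →
    hybAgree μ f Φ g S ≤
      (1 / 2) * ∏ w, ∑ a, μ w a + (1 / 2) * ∑ X : W → 𝒳, bw μ X * |cbias Φ S (fun w => f (X w))|

/-- (A6, M) PUSHFORWARD: a block-product sum of a function of the block BITS `f (X w)` equals the sum over bit
vectors `v` weighted by the product of the bit masses `massAt (μ w) f (v w)` (`Finset.prod_univ_sum` after sorting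
each block by its bit).  With A2's exactly balanced pieces the masses are `p/2` (hard) and `(1−p)/2` (easy). -/
def Pushforward : Prop :=
  ∀ (W 𝒳 : Type) [Fintype W] [DecidableEq W] [Fintype 𝒳] (μ : W → 𝒳 → ℝ) (f : 𝒳 → Bool)
    (h : (W → Bool) → ℝ),
    ∑ X : W → 𝒳, bw μ X * h (fun w => f (X w)) = ∑ v : W → Bool, (∏ w, massAt (μ w) f (v w)) * h v

/-- (A7, L → now M) RM3 EXPECTED-BIAS DECAY (O'Donnell JCSS'04 §4, here by an elementary second-moment recursion).
MOSTLY IN THE TREE ALREADY (prover-2 g6): `biasSeq_decay` (NegLimitedAmplifiedWindowBiasSeq, p475169) and, in the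
`ρ : (Fin d → Fin 3) → Option Bool` encoding, `qMoment_succ`, `qMoment_eq_biasSeq`, `rmoment_odd`, `sum_rwt_mul_abs_rbias_le`
(NegLimitedAmplifiedWindowBiasMoments, p476295) for the RECURSIVELY COMPUTED bias `rbias d ρ`.  What remains: (i) the semantic
lemma `rbias d ρ = cbias (recMaj3 d) {w | ρ w = none} (fun w => (ρ w).getD false)` (induction on `d`; the `z`-average factorises
over the three subtrees and `sgn (maj3 a b c) = (sa+sb+sc − sa·sb·sc)/2`), (ii) the `2^{|S|}`-to-1 re-indexing
`expAbsBias d p = Σ_ρ rwt p ρ · |cbias …|` (`Finset.sum_fiberwise`), (iii) `√(C·(13/16)^d) = √C·(3^d)^{-α}` with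
`α := logb 3 (16/13) / 2 ∈ (0, ½]` (`Real.rpow_logb`).  The recursion behind it: with `B_j(ρ)` the bias of `RM3_j↾ρ` and `Q_j = E_ρ B_j²` under the `p`-random restriction with fair
fixed bits: `E B_j = 0` (self-duality `recMaj3_not` + fair fixed bits), `Q_0 = 1 − p`,
`B_{j+1} = (B¹+B²+B³ − B¹B²B³)/2` for the three independent subtrees (`sgn ∘ maj3` in `±1` arithmetic; split
`(Fin (j+1) → Fin 3) ≃ Fin 3 × (Fin j → Fin 3)` along `Matrix.vecCons` as in `recMaj3`), hence
`Q_{j+1} = (3Q_j + Q_j³)/4`; decay: `1 − Q_{j+1} = (1−Q_j)(4+Q_j+Q_j²)/4 ≥ (19/16)(1−Q_j)` while `Q_j ≥ ½`, and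
`Q_{j+1} ≤ (13/16)Q_j` once `Q_j ≤ ½`; so `Q_d ≤ (16/13)^J (13/16)^d`, `J = ⌊log_{19/16}(1/(2p))⌋ + 1`, and
`expAbsBias d p ≤ √Q_d` (Cauchy–Schwarz, total weight 1) `≤ (16/13)^{J/2}·(3^d)^{-α}`, `α = ½·log₃(16/13) ≤ ½`. -/
def RM3BiasDecay : Prop :=
  ∃ α : ℝ, 0 < α ∧ α ≤ 1 / 2 ∧ ∀ p : ℝ, 0 < p → p ≤ 1 →
    ∃ K₁ : ℝ, 0 < K₁ ∧ ∀ d : ℕ, expAbsBias d p ≤ K₁ * ((3 : ℝ) ^ d) ^ (-α)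

/-- (A8, M) PROJECTION CORNER: a gate-free circuit (`size = 0`; then the size hypothesis of stub A is void, so this
case is NOT covered by the hard-core argument) outputs an input variable `x_{(w,i)}`; under `D^{⊗3^d}` with `f`
balanced the other blocks' bits are independent FAIR coins, and the probability that `RM3_d` follows one given leaf
against fair others is exactly `½ + 2^{-(d+1)}` (recursion `e_{j+1} = ¼ + e_j/2`, `e_0 = 1`), whence agreement
`≤ ½ + 2^{-(d+1)}` whatever the joint law of `(x_{(w,i)}, f(x_w))`. -/
def ProjectionCorner : Prop :=
  ∀ (ι : Type) [Fintype ι] [DecidableEq ι] (D : (ι → Bool) → ℝ) (f : (ι → Bool) → Bool) (d : ℕ)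
    (M : Circuit ((Fin d → Fin 3) × ι)), (∀ x, 0 ≤ D x) → ∑ x, D x = 1 → massAt D f true = 1 / 2 →
    M.size = 0 → agreeAt (prodWeight d D) (ampFn d f) M.eval ≤ 1 / 2 + (1 / 2) ^ (d + 1)

/-! ## A9: the assembly -/

/-- (A9, M) ASSEMBLY of stub A from A0–A8 (pure bookkeeping; recipe = BLUEPRINT-A.md §9).  Given `β > 0` take
`α` and `K₁ = K₁(β/2)` from A7, `e := 8`, `K := max (5184/β⁴) (K₁/2 + 1)`.  Given `ι, D, f, s, d, M` with
`N = 3^d`, `M.size·K·N^8 ≤ s`:  if `M.size = 0` use A8 and `2^{-(d+1)} ≤ N^{-1/2} ≤ K·N^{-α}`.  Else `s ≥ K N^8 ≥ 1`;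
the constant circuits (size 1) give `β ≤ ½`; put `γ := 1/(2N²)`, `s' := M.size + 2`; A1 applies (every
`t ≤ 4/(γβ)²+2/(γβ) ≤ 24N⁴/β²` has `t·s' + (t/2+1)(2t+1) ≤ 9t²·M.size ≤ 5184 N⁸ M.size/β⁴ ≤ s`) and gives `H`;
A2 with the class `𝒢 = {C.eval | C over {∧,∨,0,1}, size ≤ s'}` (contains both constants) and `p := β/2 ≤ (1−γ)β`
gives `H'` with `D·H'` balanced of mass `p`, advantage `≤ 4γp`;  A3' + A3 with `μ₁ := D·H'`, `μ₂ := D·(1−H')`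
expand `agreeAt (prodWeight d D) (ampFn d f) M.eval = Σ_S agreeAt (bw μ_S) F g`;  for each `S`, A0 turns the
one-block tests of `g = M.eval ∘ uncurry` into members of `𝒢`, so A4 applies with `η := 2γ`
(`Σ_a [C.eval a = f a]·DH' a = (p + Σ DH'·sgn)/2 ≤ (½ + 2γ)·p`), then A5, then A6 with the bit masses `p/2`
(hard, by A2) and `(1−p)/2` (easy: `massAt D f b = ½` minus `p/2`);  summing over `S` with
`Finset.sum_pow_mul_eq_add_pow`:  `agreeAt ≤ ½ + ½·expAbsBias d (β/2) + 2γ·N ≤ ½ + (K₁/2)·N^{-α} + N^{-1}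
≤ ½ + K·N^{-α}` by A7 and `α ≤ ½ < 1`. -/
def AmpAssembly : Prop :=
  BlockRestriction → HardCoreMonotone → BalancedTrim → MixtureExpansion → CurryBridge → HybridStep →
    FinalHybridBound → Pushforward → RM3BiasDecay → ProjectionCorner → MonotoneAmplification

/-- The registered stub `stub_monotoneAmplification : MonotoneAmplification` follows from the ten parts
(modus ponens; the content is in A0–A9). -/
theorem monotoneAmplification_of_parts (h0 : BlockRestriction) (h1 : HardCoreMonotone) (h2 : BalancedTrim)
    (h3 : MixtureExpansion) (h3' : CurryBridge) (h4 : HybridStep) (h5 : FinalHybridBound) (h6 : Pushforward)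
    (h7 : RM3BiasDecay) (h8 : ProjectionCorner) (h9 : AmpAssembly) : MonotoneAmplification :=
  h9 h0 h1 h2 h3 h3' h4 h5 h6 h7 h8

end Summit.PneNP.PneNP.Theorems.NegLimitedAmplifiedWindow.Amp
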